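import Mathlib
import Summits.NavierStokesRegularity.NavierStokesRegularity.Theorems.DssFarFieldSlavingBlowupTypeIDssProfileGaussianSmallTypeIBounds
import Summits.NavierStokesRegularity.NavierStokesRegularity.Theorems.DssFarFieldSlavingBlowupTypeIDssProfileGaussianGapCore
import HarnessLib

/-!
# Gaussian enstrophy under a small Type-I constant, file 3/4: the dissipation inequality and the
  Liouville theorem for the similarity vorticity equation (pub-ns-dss theory T38/T31 scope Row 3 =
  «T31-G»; route `DssFarFieldSlaving`, crux `BlowupTypeIDssProfile`, stmt-NavierStokesRegularity-0155 —
  SUPPORT, label-free core; typer seat g7, 2026-08-23; lead A215)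

HONEST FRAMING. Label-free analysis core about a HYPOTHETICAL object (a bounded smooth solution
family `Ω(s), U(s)` of the backward similarity vorticity equation
`∂ₛΩ = ΔΩ − Ω − ½DΩ[y] − DΩ[U] + DU[Ω]` with `div U = div Ω = 0`): IF `‖U‖ ≤ M` with
`4M² + (3√6/4)M < 1` and the Gaussian enstrophy `∫K|Ω(s)|²` is bounded on `s ∈ ℝ`, THEN `Ω ≡ 0`.
No Type-I class appears in this file (the class-level statements are file 4/4); no census word is
set here; nothing numeric; nothing here bears on Navier–Stokes regularity or blow-up.

MECHANISM (the monotone quantity). With `K = heatKernel 1`, `E = ∫K|Ω|²`, `D = ∫K‖DΩ‖²`: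
`½E′ = −Σᵢ∫K‖DΩᵢ‖² − E − ¼∫K⟪y,U⟫|Ω|² + ½∫K⟪y,Ω⟫⟪U,Ω⟫ − ∫K⟪U,DΩ[Ω]⟫` (Ornstein–Uhlenbeck
cancellation of the Leray drift, Gaussian transport identity, Gaussian stretching identity of
files 1–2); the three `U`-terms are bounded by `¾M·∫K|y||Ω|² + M√D√E`, the Gaussian moment identity
of file 1 gives `√(∫K|y|²|Ω|²) ≤ 4√D + √6√E`, hence `∫K|y||Ω|² ≤ 4√D√E + √6E`, and Young's
inequality `4M√D√E ≤ D + 4M²E` closes: `½E′ ≤ −(1 − 4M² − (3√6/4)M)E`.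

CONTENTS. `gaussianEnstrophy_pairing_le_of_small` (the slice inequality) and
**`gaussianSmall_vorticity_liouville`** (backward Grönwall, as `gaussianGap_vorticity_liouville`).
[this file; typer T31-G (typer's derivation, bus l.1579), lead A215]
-/

noncomputable section

set_option linter.dupNamespace false

namespace Summit.NavierStokesRegularity.NavierStokesRegularity.Theorems.GaussianGap

open Set Function Filter MeasureTheory InnerProductSpace Real Metric
open scoped RealInnerProductSpace Laplacian ContDiff Topology BigOperators
open Literature.Analysis Literature.Analysis.FluidPDE Literature.Analysis.UnboundedOperators
open Summit.NavierStokesRegularity.NavierStokesRegularity.Theorems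

/-- The constant of T31-G: `4M² + (3√6/4)M < 1` holds iff `0 ≤ M < m₀ = (√(16 + 27/8) − 3√6/4)/8
≈ 0.3206` (for `M ≥ 0`); recorded here only through the polynomial condition. The threshold
function. [this file] -/
theorem gaussianSmall_rate_pos {M : ℝ} (hM : 4 * M ^ 2 + (3 * Real.sqrt 6 / 4) * M < 1) :
    0 < 1 - 4 * M ^ 2 - (3 * Real.sqrt 6 / 4) * M := by linarith

/-- **The Gaussian-enstrophy dissipation inequality for one slice under a small velocity bound**
(the heart of T31-G): for `Ω ∈ C²`, `U ∈ C¹`, both divergence free, with bounds `K₀` on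
`Ω, DΩ, D²Ω, U, DU` and `‖U‖ ≤ M` (`M ≥ 0`),
`2∫K⟪Ω, ΔΩ − Ω − ½DΩ[y] − DΩ[U] + DU[Ω]⟫ ≤ −2(1 − 4M² − (3√6/4)M) ∫K|Ω|²`. See the module
docstring for the five-line derivation. [this file; typer T31-G] -/
theorem gaussianEnstrophy_pairing_le_of_small {Ω U : EuclideanSpace ℝ (Fin 3) → EuclideanSpace ℝ (Fin 3)}
    {K₀ M : ℝ} (hΩ : ContDiff ℝ 2 Ω) (hU : ContDiff ℝ 1 U) (hdiv : VectorCalculus.IsDivFree U)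
    (hdivΩ : VectorCalculus.IsDivFree Ω)
    (h0 : ∀ y, ‖Ω y‖ ≤ K₀) (h1 : ∀ y, ‖fderiv ℝ Ω y‖ ≤ K₀) (h2 : ∀ y, ‖iteratedFDeriv ℝ 2 Ω y‖ ≤ K₀)
    (h3 : ∀ y, ‖U y‖ ≤ K₀) (h4 : ∀ y, ‖fderiv ℝ U y‖ ≤ K₀)
    (hM0 : 0 ≤ M) (hUM : ∀ y, ‖U y‖ ≤ M) :
    ∫ y, heatKernel 1 y * (2 * ⟪Ω y,
        (Δ Ω) y - Ω y - (1 / 2 : ℝ) • fderiv ℝ Ω y y - fderiv ℝ Ω y (U y) + fderiv ℝ U y (Ω y)⟫) ≤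
      -(2 * (1 - 4 * M ^ 2 - (3 * Real.sqrt 6 / 4) * M)) * ∫ y, heatKernel 1 y * ‖Ω y‖ ^ 2 := by
  have hΩ1 : ContDiff ℝ 1 Ω := hΩ.of_le (by norm_num)
  -- the four identities (file 1 of T41, file 1 of T31-G) and the expansion (file 2)
  have hOU := integral_heatKernel_inner_laplacian_sub_half_fderiv hΩ h0 h1 h2
  have hTR := integral_heatKernel_inner_convect hU hΩ1 hdiv h3 h0 h1
  have hST := integral_heatKernel_inner_stretching_eq hU hΩ1 hdivΩ h3 h0 h4 h1
  have hMO := integral_heatKernel_norm_sq_mul_norm_sq_eq hΩ1 h0 h1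
  have hexp := gaussianEnstrophy_pairing_expand hΩ hU h0 h1 h2 h3 h4
  -- the bounds (file 2)
  have hDle := integral_heatKernel_norm_fderiv_sq_le_sum hΩ1 h1
  have hA := neg_integral_heatKernel_inner_fderiv_apply_le hΩ1 hU h0 h1 h3 hM0 hUM
  have hW := integral_heatKernel_norm_mul_norm_sq_le hΩ1 h0
  have hC := integral_heatKernel_inner_fderiv_apply_self_le hΩ1 h0 h1
  have hB1 := neg_integral_heatKernel_flux_le hΩ1 hU h0 h3 hUM
  have hB2 := integral_heatKernel_cross_moment_le hΩ1 hU h0 h3 hUM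
  -- abbreviations (all integrals become atoms)
  set E : ℝ := ∫ y, heatKernel 1 y * ‖Ω y‖ ^ 2 with hE
  set Dsum : ℝ := ∑ i, ∫ y, heatKernel 1 y * ‖fderiv ℝ (fun z => Ω z i) y‖ ^ 2 with hDsum
  set Dop : ℝ := ∫ y, heatKernel 1 y * ‖fderiv ℝ Ω y‖ ^ 2 with hDop
  set Y : ℝ := ∫ y, heatKernel 1 y * (‖y‖ ^ 2 * ‖Ω y‖ ^ 2) with hY
  set W : ℝ := ∫ y, heatKernel 1 y * (‖y‖ * ‖Ω y‖ * ‖Ω y‖) with hWdef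
  set J : ℝ := ∫ y, heatKernel 1 y * ⟪fderiv ℝ Ω y y, Ω y⟫ with hJ
  set F : ℝ := ∫ y, heatKernel 1 y * (⟪y, U y⟫ * ‖Ω y‖ ^ 2) with hF
  set G : ℝ := ∫ y, heatKernel 1 y * (⟪y, Ω y⟫ * ⟪U y, Ω y⟫) with hG
  set T : ℝ := ∫ y, heatKernel 1 y * ⟪U y, fderiv ℝ Ω y (Ω y)⟫ with hT
  have hE0 : 0 ≤ E := integral_nonneg fun y => mul_nonneg (heatKernel_one_pos y).le (by positivity)
  have hDop0 : 0 ≤ Dop := integral_nonneg fun y => mul_nonneg (heatKernel_one_pos y).le (by positivity)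
  have hY0 : 0 ≤ Y := integral_nonneg fun y => mul_nonneg (heatKernel_one_pos y).le (by positivity)
  rw [hexp, hOU, hTR, hST]
  clear hexp hOU hTR hST
  -- the algebra in `e = √E`, `d = √Dop`, `w = √Y`
  set e : ℝ := Real.sqrt E with he
  set d : ℝ := Real.sqrt Dop with hd
  set w : ℝ := Real.sqrt Y with hw
  have he0 : 0 ≤ e := Real.sqrt_nonneg _
  have hd0 : 0 ≤ d := Real.sqrt_nonneg _
  have hw0 : 0 ≤ w := Real.sqrt_nonneg _
  have hee : e * e = E := Real.mul_self_sqrt hE0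
  have hdd : d * d = Dop := Real.mul_self_sqrt hDop0
  have hww : w * w = Y := Real.mul_self_sqrt hY0
  have h6 : Real.sqrt 6 * Real.sqrt 6 = 6 := Real.mul_self_sqrt (by norm_num)
  have hs6 : 0 ≤ Real.sqrt 6 := Real.sqrt_nonneg _
  -- `w ≤ 4d + √6 e` from `w² = 6e² + 4J ≤ 6e² + 4dw`
  have hw2 : w * w ≤ 6 * (e * e) + 4 * (d * w) := by
    rw [hww, hee]; linarith only [hMO, hC]
  have hwle : w ≤ 4 * d + Real.sqrt 6 * e := by
    by_contra hc
    rw [not_le] at hc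
    have hwpos : 0 < w := lt_of_le_of_lt (by positivity) hc
    have h1' : (4 * d + Real.sqrt 6 * e) * w < w * w := mul_lt_mul_of_pos_right hc hwpos
    have hle : Real.sqrt 6 * e ≤ w := by linarith only [hc, hd0]
    have h2' : Real.sqrt 6 * e * (Real.sqrt 6 * e) ≤ Real.sqrt 6 * e * w :=
      mul_le_mul_of_nonneg_left hle (by positivity)
    have h2'' : 6 * (e * e) ≤ Real.sqrt 6 * e * w := by
      have hsq : Real.sqrt 6 * e * (Real.sqrt 6 * e) = 6 * (e * e) := by
        rw [show Real.sqrt 6 * e * (Real.sqrt 6 * e) = (Real.sqrt 6 * Real.sqrt 6) * (e * e) by ring,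
          h6]
      linarith only [h2', hsq]
    linarith only [hw2, h1', h2'']
  -- `W ≤ w e ≤ 4 d e + √6 e²`
  have hWle : W ≤ 4 * (d * e) + Real.sqrt 6 * (e * e) := by
    have := mul_le_mul_of_nonneg_right hwle he0
    linarith only [hW, this]
  -- Young: `4 M d e ≤ d² + 4 M² e²`
  have hYoung : 4 * M * (d * e) ≤ d * d + 4 * M ^ 2 * (e * e) := by
    linarith only [sq_nonneg (d - 2 * M * e)]
  -- `¾ M W ≤ 3 M d e + (3√6/4) M e²`
  have hMW : M * W ≤ M * (4 * (d * e) + Real.sqrt 6 * (e * e)) := mul_le_mul_of_nonneg_left hWle hM0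
  -- assemble (linear in the monomials `Dsum, d², MW, Mde, √6·Me², M²e², E, F, G, T`)
  have hDs : -Dsum ≤ -(d * d) := by rw [hdd]; linarith only [hDle]
  linear_combination 2 * hDs + (1 / 2 : ℝ) * hB1 + hB2 + 2 * hA + (3 / 2 : ℝ) * hMW + 2 * hYoung +
    (8 * M ^ 2 + 3 * Real.sqrt 6 / 2 * M) * hee

/-- **The small-Type-I Liouville theorem for the similarity vorticity equation** (T31-G, core form).
HONEST FRAMING: a Liouville statement about a HYPOTHETICAL smooth bounded solution family of the
backward similarity vorticity equation; class-level only through file 4/4; nothing here bears on NS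
regularity. Hypotheses: slice regularity (`Ω(s) ∈ C²`, `U(s) ∈ C¹`, `div U(s) = div Ω(s) = 0`),
locally-in-`s` uniform bounds on `Ω, DΩ, D²Ω, U, DU`, the vorticity equation as an `s`-derivative,
`‖U‖ ≤ M` with `0 ≤ M` and `4M² + (3√6/4)M < 1`, bounded Gaussian enstrophy. Conclusion: `Ω ≡ 0`
(`gaussianEnstrophy_pairing_le_of_small` + backward Grönwall `eq_zero_of_deriv_le_neg_mul`).
[this file; typer T31-G] -/
theorem gaussianSmall_vorticity_liouville
    {Ω U : ℝ → EuclideanSpace ℝ (Fin 3) → EuclideanSpace ℝ (Fin 3)} {M B : ℝ}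
    (hΩ2 : ∀ s, ContDiff ℝ 2 (Ω s)) (hU1 : ∀ s, ContDiff ℝ 1 (U s))
    (hdiv : ∀ s, VectorCalculus.IsDivFree (U s)) (hdivΩ : ∀ s, VectorCalculus.IsDivFree (Ω s))
    (hbdd : ∀ s₀ : ℝ, ∃ ε > 0, ∃ K₀ : ℝ, ∀ s ∈ Ioo (s₀ - ε) (s₀ + ε), ∀ y,
      ‖Ω s y‖ ≤ K₀ ∧ ‖fderiv ℝ (Ω s) y‖ ≤ K₀ ∧ ‖iteratedFDeriv ℝ 2 (Ω s) y‖ ≤ K₀ ∧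
        ‖U s y‖ ≤ K₀ ∧ ‖fderiv ℝ (U s) y‖ ≤ K₀)
    (heq : ∀ s y, HasDerivAt (fun σ => Ω σ y)
      ((Δ (Ω s)) y - Ω s y - (1 / 2 : ℝ) • fderiv ℝ (Ω s) y y - fderiv ℝ (Ω s) y (U s y) +
        fderiv ℝ (U s) y (Ω s y)) s)
    (hM0 : 0 ≤ M) (hUM : ∀ s y, ‖U s y‖ ≤ M)
    (hM : 4 * M ^ 2 + (3 * Real.sqrt 6 / 4) * M < 1)
    (hZb : ∀ s, ∫ y, heatKernel 1 y * ‖Ω s y‖ ^ 2 ≤ B) :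
    ∀ s y, Ω s y = 0 := by
  set Z : ℝ → ℝ := fun s => ∫ y, heatKernel 1 y * ‖Ω s y‖ ^ 2 with hZ_def
  set Z' : ℝ → ℝ := fun s => ∫ y, heatKernel 1 y * (2 * ⟪Ω s y,
    (Δ (Ω s)) y - Ω s y - (1 / 2 : ℝ) • fderiv ℝ (Ω s) y y - fderiv ℝ (Ω s) y (U s y) +
      fderiv ℝ (U s) y (Ω s y)⟫) with hZ'_def
  set κ : ℝ := 1 - 4 * M ^ 2 - (3 * Real.sqrt 6 / 4) * M with hκ
  have hκpos : 0 < κ := gaussianSmall_rate_pos hM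
  have hZd : ∀ s, HasDerivAt Z (Z' s) s := by
    intro s
    obtain ⟨ε, hε, K₀, hK⟩ := hbdd s
    exact gaussianEnstrophy_hasDerivAt hΩ2 hU1 hε hK heq
  have hineq : ∀ s, Z' s ≤ -(2 * κ) * Z s := by
    intro s
    obtain ⟨ε, hε, K₀, hK⟩ := hbdd s
    have hKs := hK s (by constructor <;> linarith)
    exact gaussianEnstrophy_pairing_le_of_small (hΩ2 s) (hU1 s) (hdiv s) (hdivΩ s)
      (fun y => (hKs y).1) (fun y => (hKs y).2.1) (fun y => (hKs y).2.2.1) (fun y => (hKs y).2.2.2.1)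
      (fun y => (hKs y).2.2.2.2) hM0 (hUM s)
  have hZ0 : ∀ s, Z s = 0 := by
    intro s
    have hnn : ∀ σ ≤ s, 0 ≤ Z σ := fun σ _ =>
      integral_nonneg fun y => mul_nonneg (heatKernel_one_pos y).le (by positivity)
    exact eq_zero_of_deriv_le_neg_mul (Z := Z) (Z' := Z') (mul_pos two_pos hκpos) hnn
      (fun σ _ => hZb σ) (fun σ _ => hZd σ) (fun σ _ => hineq σ) s le_rfl
  intro s y
  obtain ⟨ε, hε, K₀, hK⟩ := hbdd s
  exact eq_zero_of_integral_heatKernel_mul_norm_sq_eq_zero ((hΩ2 s).continuous)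
    (fun z => (hK s (by constructor <;> linarith) z).1) (hZ0 s) y

end Summit.NavierStokesRegularity.NavierStokesRegularity.Theorems.GaussianGap
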